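import Literature.AlgebraicGeometry.Motives.CurveGenusBaseChange
import Literature.AlgebraicGeometry.Motives.SymmetricPowerSplitDivisors
import HarnessLib

/-!
# Degrees of divisors are invariant under extension of the base field
# (Görtz–Wedhorn II Cor. 22.91 via `h⁰`; Stichtenoth Thm. 3.6.3 (conorm preserves degrees))

For a smooth proper geometrically integral curve `C / K`, fields `L₀ → L₁` over `K`
(`m : Spec L₁ → Spec L₀`) and a Cartier divisor `D` on `C_{L₀}`, the pullback
`D_{L₁} = fieldExtPullback C m D` on `C_{L₁}` (`Motives/SymmetricPowerSplitDivisors`) has the same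
degree: **`degree_toDivisor_fieldExtPullback : deg D_{L₁} = deg D`** (degrees of the divisors of
the function fields, `toDivisor`). As for the genus (`Motives/CurveGenusBaseChange`) the proof reads
the degree off the asymptotics of `h⁰` (`genus_eq_of_ell_nsmul_eq`, degree part), which is
invariant under field extension (`Motives/H0FieldExtension`):

* `LinEquiv.toDivisor_isLinearlyEquivalent`, `LinEquiv.degree_toDivisor_eq` — linearly equivalent
  Cartier divisors have linearly equivalent divisors of the function field, hence equal degree;
* `degree_toDivisor_classPullback_eq_of_pos`, `degree_toDivisor_classPullback_eq` — an
  `h⁰`-preserving morphism of curves preserves degrees (first for positive degree, then for all `D`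
  via `deg D = deg (D + N [x]) − N deg [x]`);
* `degree_toDivisor_fieldExtPullback`.

Everything is proved; no named facts (D-0026). Part of the construction of the Jacobian
(`nonempty_jacobian_of_isSmoothProjective`): degrees of the divisors `Σ tᵢ`, `D_{F'}` do not
change under the field extensions used for splitting and descent.

## References

* U. Görtz, T. Wedhorn, *Algebraic Geometry II* (2023), Cor. 22.91 (p. 388). [GortzWedhorn2023]
* H. Stichtenoth, *Algebraic Function Fields and Codes*, 2nd ed. (2009), Thm. 3.6.3. [Stichtenoth2009]
-/

noncomputable section

open CategoryTheory CategoryTheory.Limits AlgebraicGeometry IsLocalRing Order TopologicalSpace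
  MonoidalCategory CartesianMonoidalCategory

universe u

namespace Literature.AlgebraicGeometry.Motives

open Literature.AlgebraicGeometry.RelativeSpec

namespace CurvePlaces

open RatFn FieldPoint CartierDivisor Literature.NumberTheory.DiophantineGeometry
  Literature.NumberTheory.DiophantineGeometry.AlgFunctionField

/-! ### Linearly equivalent Cartier divisors have linearly equivalent, hence equal-degree, divisors -/

section LinEquivDegree

variable {L : Type u} [Field L] (X : SchemeOver L) [IsIntegral X.left]
  [SmoothOfRelativeDimension 1 X.hom] [IsProper X.hom]

/-- `D ∼ E` gives `toDivisor D − toDivisor E = (h)` principal. [folklore] -/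
theorem LinEquiv.toDivisor_isLinearlyEquivalent {D E : CartierDivisor X.left} (h : D.LinEquiv E) :
    (toDivisor X E).IsLinearlyEquivalent (toDivisor X D) := by
  obtain ⟨f, hf, H⟩ := h
  have hE : toDivisor X E = toDivisor X D + principalDivisor L f := by
    rw [← SameDivisor.toDivisor_eq (C := X) H, toDivisor_add, toDivisor_principal]
  refine ⟨f, hf, ?_⟩
  rw [hE]; abel

/-- **Linearly equivalent Cartier divisors have the same degree** (`deg (h) = 0`). [folklore] -/
theorem LinEquiv.degree_toDivisor_eq [GeometricallyIntegral X.hom] {D E : CartierDivisor X.left}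
    (h : D.LinEquiv E) : (toDivisor X D).degree = (toDivisor X E).degree :=
  (Divisor.degree_eq_of_isLinearlyEquivalent (LinEquiv.toDivisor_isLinearlyEquivalent X h)).symm

/-- `toDivisor` of `sumDivisor` of a constant family: `n • toDivisor D`. [folklore] -/
theorem degree_toDivisor_nsmulDivisor (n : ℕ) (D : CartierDivisor X.left) :
    (toDivisor X (nsmulDivisor n D)).degree = n * (toDivisor X D).degree := by
  rw [toDivisor_nsmulDivisor, map_nsmul, nsmul_eq_mul]

end LinEquivDegree

/-! ### Degrees under `h⁰`-preserving morphisms -/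

section Compare

variable {L₀ : Type u} [Field L₀] (X₀ : SchemeOver L₀) [IsIntegral X₀.left]
  [SmoothOfRelativeDimension 1 X₀.hom] [IsProper X₀.hom] [GeometricallyIntegral X₀.hom]
  {L₁ : Type u} [Field L₁] (X₁ : SchemeOver L₁) [IsIntegral X₁.left]
  [SmoothOfRelativeDimension 1 X₁.hom] [IsProper X₁.hom] [GeometricallyIntegral X₁.hom]
  (φ : X₁.left ⟶ X₀.left)
  (H : ∀ D : CartierDivisor X₀.left, (D.classPullback φ).h0 L₁ = D.h0 L₀)

include H in
/-- For divisors of positive degree, `h⁰`-preserving morphisms preserve the degree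
(`genus_eq_of_ell_nsmul_eq`, degree part). [folklore] -/
theorem degree_toDivisor_classPullback_eq_of_pos (D : CartierDivisor X₀.left)
    (hD : 0 < (toDivisor X₀ D).degree) :
    (toDivisor X₁ (D.classPullback φ)).degree = (toDivisor X₀ D).degree := by
  have hell : ∀ n : ℕ, ell (n • toDivisor X₁ (D.classPullback φ)) = ell (n • toDivisor X₀ D) := by
    intro n
    rw [← h0_nsmulDivisor X₀ n D, ← h0_nsmulDivisor X₁ n (D.classPullback φ), ← H]
    exact ((classPullback_sumDivisor_linEquiv φ fun _ : Fin n ↦ D).h0_eq (K := L₁)).symm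
  exact (genus_eq_of_ell_nsmul_eq _ _ hD hell).2

include H in
/-- **`h⁰`-preserving morphisms preserve the degree of every divisor**: write
`deg D = deg (D + N [x]) − N deg [x]` with `N` large. [folklore] -/
theorem degree_toDivisor_classPullback_eq (D : CartierDivisor X₀.left) :
    (toDivisor X₁ (D.classPullback φ)).degree = (toDivisor X₀ D).degree := by
  -- a closed point `x` of `X₀`, its divisor `P` of degree `dP ≥ 1`
  obtain ⟨v⟩ := nonempty_placeOver (K := L₀) (F := X₀.left.functionField)
  have hx : pointOfPlace (C := X₀) v ≠ genericPoint X₀.left := pointOfPlace_ne_genericPoint v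
  set P := pointDivisor X₀ hx
  have hP : toDivisor X₀ P = Finsupp.single (place X₀ _ hx) 1 := toDivisor_pointDivisor hx
  have hdP : 1 ≤ (toDivisor X₀ P).degree := by
    rw [hP, Divisor.degree_single, one_mul]
    exact_mod_cast PlaceOver.degree_pos_holds (K := L₀) (place X₀ _ hx)
  -- `N` with `deg D + N dP > 0`
  set N : ℕ := (toDivisor X₀ D).degree.natAbs + 1
  set DN := D + nsmulDivisor N P
  have hDN : toDivisor X₀ DN = toDivisor X₀ D + N • toDivisor X₀ P := by
    rw [toDivisor_add, toDivisor_nsmulDivisor]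
  have hpos : 0 < (toDivisor X₀ DN).degree := by
    rw [hDN, map_add, map_nsmul, nsmul_eq_mul]
    have h1 : -((toDivisor X₀ D).degree.natAbs : ℤ) ≤ (toDivisor X₀ D).degree := by omega
    have h2 : (N : ℤ) = (toDivisor X₀ D).degree.natAbs + 1 := by simp [N]
    nlinarith
  -- degrees upstairs
  have hDN' := degree_toDivisor_classPullback_eq_of_pos X₀ X₁ φ H DN hpos
  have hP' := degree_toDivisor_classPullback_eq_of_pos X₀ X₁ φ H P (by omega)
  -- `(DN).cp ∼ D.cp + N • P.cp`
  have hsplit : (DN.classPullback φ).LinEquiv (D.classPullback φ + nsmulDivisor N (P.classPullback φ)) :=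
    (classPullback_add_linEquiv φ D _).trans
      ((LinEquiv.refl _).add (classPullback_sumDivisor_linEquiv φ fun _ : Fin N ↦ P))
  have hdeg := LinEquiv.degree_toDivisor_eq X₁ hsplit
  rw [toDivisor_add, map_add, degree_toDivisor_nsmulDivisor] at hdeg
  rw [hDN, map_add, map_nsmul, nsmul_eq_mul] at hDN'
  rw [hP'] at hdeg
  linarith

end Compare

/-! ### Base change along field extensions -/

section FieldExt

variable {K : Type u} [Field K] (C : SchemeOver K) [IsIntegral C.left]
  [SmoothOfRelativeDimension 1 C.hom] [IsProper C.hom] [GeometricallyIntegral C.hom]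
  {L₀ L₁ : Type u} [Field L₀] [Field L₁] {π₀ : Spec (.of L₀) ⟶ Spec (.of K)}
  {π₁ : Spec (.of L₁) ⟶ Spec (.of K)} (m : Over.mk π₁ ⟶ Over.mk π₀)

omit [IsIntegral C.left] in
/-- **The degree of a divisor is invariant under extension of the base field**:
`deg D_{L₁} = deg D` for the pullback `D_{L₁}` of a Cartier divisor `D` on `C_{L₀}` to `C_{L₁}`
(`h⁰` is invariant, `Motives/H0FieldExtension`; asymptotics of Riemann–Roch,
`genus_eq_of_ell_nsmul_eq`). [cite: GortzWedhorn2023, Cor. 22.91 (p. 388)] -/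
theorem degree_toDivisor_fieldExtPullback (D : CartierDivisor (curveBC C π₀).left) :
    (toDivisor (curveBC C π₁) (fieldExtPullback C m D)).degree = (toDivisor (curveBC C π₀) D).degree := by
  have h1 : (toDivisor (curveBC C π₁) (fieldExtPullback C m D)).degree =
      (toDivisor (curveBC C π₁) (D.classPullback (bcHom C m))).degree :=
    (LinEquiv.degree_toDivisor_eq (curveBC C π₁) (classPullback_linEquiv_pullback (bcHom C m) D)).symm
  rw [h1]
  exact degree_toDivisor_classPullback_eq (curveBC C π₀) (curveBC C π₁) (bcHom C m)
    (fun E ↦ h0_classPullback_whiskerLeft_fieldExt_eq C m E) D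

end FieldExt

end CurvePlaces

end Literature.AlgebraicGeometry.Motives
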